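import Mathlib
import HarnessLib
import Literature.MathematicalPhysics.KineticTheory.LangevinChainNoiseContinuity
import Literature.MathematicalPhysics.KineticTheory.LangevinChainGeneratorStep
import Literature.MathematicalPhysics.KineticTheory.VelocityFlipEmbeddedChainSteadyState
import Literature.Probability.Process.BrownianSupTail

/-!
# Continuity of the flip-free transition semigroup and of its resolvent in the bath temperatures
(helper for stub CONT `stub_flipMildContinuity`, line `fekete-usc-one-length`, crux stmt-AtomisticToContinuum-11976)

`--supports stmt-AtomisticToContinuum-11976` helper file (crux `VanishingNoiseBound`, route `VanishingNoiseTransfer`,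
line `fekete-usc-one-length`, stub CONT, wave 5). Step (3), compact part, of the perturbation argument of CONT: for the
pinned chain `pinnedChain ω₂ lam β γ` the transition kernels `P_t = law(Φ_t(z, B))` (`LangevinChainKernel.lean`) depend
on the bath temperatures only through the noise amplitudes `√(2γT_b)` multiplying the Brownian pair inside the
pathwise flow `chainFlow` (`LangevinChainSDE.lean`), which is Lipschitz in the noise path on bounded sets
(`LangevinChainNoiseContinuity.lean`). Hence, for BOUNDED continuous observables `g`:

* `chainNoise_sub` — the noise is linear in the amplitudes;
* `flow_expectation_continuous_temps` — `sup_{H(z) ≤ E, t ≤ t_max} |E g(Φ^{T_L,T_R}_t z) − E g(Φ^{T_L⁰,T_R⁰}_t z)| → 0`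
  as `(T_L, T_R) → (T_L⁰, T_R⁰)` (good event `{sup_{[0,t_max]} |B^b| ≤ a}` of `BrownianSupTail.lean` with small
  complement; on it the noises are uniformly close, the flows are uniformly close
  (`pinnedChain_exists_norm_chainFlow_sub_lt`) and stay in a fixed ball (`pinnedChain_norm_chainFlow_le`), where `g`
  is uniformly continuous);
* `resolvent_continuous_temps` — the same for the resolvent kernels `R_r = ∫₀^∞ r e^{-rt} P_t dt`
  (`VelocityFlipEmbeddedChain.lean`): truncate the exponential time;
* `helper_flipMildContinuityFlow` — registered helper (notation-free restatement of `resolvent_continuous_temps`).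

References: Cuneo–Eckmann–Hairer–Rey-Bellet 2018 §2–3; Stroock–Varadhan 1972 (support theorem, pathwise part);
Ethier–Kurtz 1986 Ch. 1 §2.
-/

noncomputable section

open MeasureTheory ProbabilityTheory Filter Topology Set Metric
open scoped NNReal ENNReal Topology
open Literature.MathematicalPhysics.KineticTheory.HeatConduction Literature.Probability.Process OscillatorChain

namespace Summit.AtomisticToContinuum.FouriersLaw.Theorems.VanishingNoiseBound

variable {N : ℕ}

-- the flow is a limit of Picard iterations: never let the unifier unfold it (heartbeats)
attribute [local irreducible] OscillatorChain.chainFlow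

/-- The momentum noise is linear in the amplitudes: `η^{c} − η^{c'} = η^{c − c'}`. [folklore] -/
theorem chainNoise_sub (c_L c_R c_L' c_R' : ℝ) (w : WienerPair) (t : ℝ) :
    chainNoise N c_L c_R w t - chainNoise N c_L' c_R' w t = chainNoise N (c_L - c_L') (c_R - c_R') w t := by
  funext i
  simp only [chainNoise, Pi.sub_apply]
  split_ifs <;> ring

/-- A level `a ≥ 1` of the Brownian running maxima on `[0, h]` beyond which the bad event has probability
`≤ q`: `P((goodEvent a h)ᶜ) ≤ ofReal q` for `q > 0`. [folklore] -/
theorem exists_goodEvent_compl_le (h : ℝ≥0) {q : ℝ} (hq : 0 < q) :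
    ∃ a : ℝ, 1 ≤ a ∧ wienerPair (goodEvent a h)ᶜ ≤ ENNReal.ofReal q := by
  -- `a² = h + √Q + 1` with `Q = 8h²/q`, so that `2 · 2h²/(a² − h)² ≤ 4h²/Q ≤ q/2 ≤ q`
  set Q : ℝ := 8 * (h : ℝ) ^ 2 / q with hQ
  have hQ0 : 0 ≤ Q := by positivity
  set a : ℝ := Real.sqrt ((h : ℝ) + Real.sqrt Q + 1) with ha
  have hh0 : (0 : ℝ) ≤ h := h.coe_nonneg
  have ha2 : a ^ 2 = (h : ℝ) + Real.sqrt Q + 1 := by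
    rw [ha, Real.sq_sqrt (by positivity)]
  have ha1 : 1 ≤ a := by
    rw [ha, Real.le_sqrt' one_pos]
    nlinarith [Real.sqrt_nonneg Q]
  have hha : (h : ℝ) < a ^ 2 := by rw [ha2]; nlinarith [Real.sqrt_nonneg Q]
  refine ⟨a, ha1, (measure_compl_goodEvent_le (zero_le_one.trans ha1) h hha).trans ?_⟩
  rw [← ENNReal.ofReal_ofNat 2, ← ENNReal.ofReal_mul zero_le_two]
  refine ENNReal.ofReal_le_ofReal ?_
  have hden : a ^ 2 - h = Real.sqrt Q + 1 := by rw [ha2]; ring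
  rw [hden]
  have hsq : Q ≤ (Real.sqrt Q + 1) ^ 2 := by
    nlinarith [Real.sq_sqrt hQ0, Real.sqrt_nonneg Q]
  have hpos : 0 < (Real.sqrt Q + 1) ^ 2 := by positivity
  rw [mul_div_assoc', div_le_iff₀ hpos]
  calc 2 * (2 * (h : ℝ) ^ 2) = (q / 2) * Q := by rw [hQ]; field_simp; ring
    _ ≤ q * (Real.sqrt Q + 1) ^ 2 := by nlinarith

variable {ω₂ lam β γ : ℝ}

set_option maxHeartbeats 1600000 in
/-- **The flow expectations of bounded continuous observables are continuous in the bath temperatures, uniformly on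
energy sublevel sets and bounded time intervals.** For `pinnedChain ω₂ lam β γ` (`ω₂ > 0`, `lam, β, γ ≥ 0`), a
bounded continuous `g` (`|g| ≤ B`), an energy level `E`, a horizon `t_max`, base temperatures `(T_L⁰, T_R⁰)` and
`e > 0` there is `δ' > 0` such that `|T_L − T_L⁰|, |T_R − T_R⁰| < δ'` imply
`|E g(Φ^{T_L,T_R}_t(z, B)) − E g(Φ^{T_L⁰,T_R⁰}_t(z, B))| ≤ e` for all `z` with `H(z) ≤ E` and all `t ∈ [0, t_max]`.
[cite: CuneoEckmannHairerReyBellet2018, §3.1 Cor. 3.4] -/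
theorem flow_expectation_continuous_temps (hω : 0 < ω₂) (hl : 0 ≤ lam) (hβ : 0 ≤ β) (hγ : 0 ≤ γ)
    {g : PhaseSpace N → ℝ} (hg : Continuous g) {B : ℝ} (hB : ∀ x, |g x| ≤ B) (E tmax : ℝ) (T_L₀ T_R₀ : ℝ)
    {e : ℝ} (he : 0 < e) :
    ∃ δ' : ℝ, 0 < δ' ∧ ∀ T_L T_R : ℝ, |T_L - T_L₀| < δ' → |T_R - T_R₀| < δ' →
      ∀ z : PhaseSpace N, (pinnedChain ω₂ lam β γ).hamiltonian N z ≤ E → ∀ t ∈ Icc (0 : ℝ) tmax,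
        |∫ ω, g ((pinnedChain ω₂ lam β γ).solMap N T_L T_R t z (pairPath ω)) ∂wienerPair -
            ∫ ω, g ((pinnedChain ω₂ lam β γ).solMap N T_L₀ T_R₀ t z (pairPath ω)) ∂wienerPair| ≤ e := by
  set P := pinnedChain ω₂ lam β γ with hP
  have hB0 : 0 ≤ B := (abs_nonneg _).trans (hB 0)
  -- (1) the good event of the Brownian pair on `[0, t_max]`, bad probability `≤ e/(4(B+1))`
  set h : ℝ≥0 := tmax.toNNReal with hh
  have hq : 0 < e / (4 * (B + 1)) := by positivity
  obtain ⟨a, ha1, hbad⟩ := exists_goodEvent_compl_le h hq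
  have ha0 : 0 < a := one_pos.trans_le ha1
  set G := goodEvent a h with hG
  have hGm : MeasurableSet G := measurableSet_goodEvent a h
  -- (2) amplitudes: base values, a common bound with slack `1`, the noise bound `Mη` on the good event
  set cL₀ : ℝ := Real.sqrt (2 * γ * T_L₀) with hcL₀
  set cR₀ : ℝ := Real.sqrt (2 * γ * T_R₀) with hcR₀
  set cM : ℝ := cL₀ + cR₀ + 2 with hcM
  have hcM0 : 0 ≤ cM := by positivity
  set Mη : ℝ := cM * a with hMη
  -- (3) the a-priori ball and uniform continuity of `g` on it
  set Rap : ℝ := pinnedChainRadius ω₂ lam β γ N E Mη tmax with hRap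
  obtain ⟨δu, hδu, huc⟩ := Metric.uniformContinuousOn_iff.1
    ((isCompact_closedBall (0 : PhaseSpace N) (Rap + 1)).uniformContinuousOn_of_continuous hg.continuousOn)
    (e / 2) (half_pos he)
  -- (4) continuity of the flow in the noise path, uniformly on `{H ≤ E}`
  obtain ⟨δf, hδf, hflow⟩ := pinnedChain_exists_norm_chainFlow_sub_lt hω hl hβ hγ N E Mη tmax
    (lt_min hδu one_pos)
  -- (5) continuity of the amplitudes
  set ηa : ℝ := min (δf / (2 * a)) 1 with hηa
  have hηa0 : 0 < ηa := lt_min (by positivity) one_pos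
  have hsq : ∀ T₀ : ℝ, ∃ δ₁ : ℝ, 0 < δ₁ ∧ ∀ T' : ℝ, |T' - T₀| < δ₁ →
      |Real.sqrt (2 * γ * T') - Real.sqrt (2 * γ * T₀)| < ηa := by
    intro T₀
    have hc : ContinuousAt (fun x : ℝ => Real.sqrt (2 * γ * x)) T₀ :=
      (Real.continuous_sqrt.comp (continuous_const.mul continuous_id)).continuousAt
    obtain ⟨δ₁, hδ₁, hδ₁'⟩ := Metric.continuousAt_iff.1 hc ηa hηa0
    exact ⟨δ₁, hδ₁, fun T' hT' => by
      have := hδ₁' (x := T') (by rwa [Real.dist_eq])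
      rwa [Real.dist_eq] at this⟩
  obtain ⟨δL, hδL, hδL'⟩ := hsq T_L₀
  obtain ⟨δR, hδR, hδR'⟩ := hsq T_R₀
  refine ⟨min δL δR, lt_min hδL hδR, fun T_L T_R hTL hTR z hz t ht => ?_⟩
  have hdL := hδL' T_L (hTL.trans_le (min_le_left _ _))
  have hdR := hδR' T_R (hTR.trans_le (min_le_right _ _))
  set cL : ℝ := Real.sqrt (2 * γ * T_L) with hcL
  set cR : ℝ := Real.sqrt (2 * γ * T_R) with hcR
  have hcLb : |cL| ≤ cL₀ + 1 := by
    rw [abs_of_nonneg (Real.sqrt_nonneg _)]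
    have := (abs_lt.1 hdL).2; linarith [min_le_right (δf / (2 * a)) 1]
  have hcRb : |cR| ≤ cR₀ + 1 := by
    rw [abs_of_nonneg (Real.sqrt_nonneg _)]
    have := (abs_lt.1 hdR).2; linarith [min_le_right (δf / (2 * a)) 1]
  have hcL₀b : |cL₀| ≤ cL₀ + 1 := by rw [abs_of_nonneg (Real.sqrt_nonneg _)]; linarith
  have hcR₀b : |cR₀| ≤ cR₀ + 1 := by rw [abs_of_nonneg (Real.sqrt_nonneg _)]; linarith
  -- (6) pointwise bound: `|g(Φ) − g(Φ⁰)| ≤ e/2 + 2B·1_{Gᶜ}`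
  set F : WienerPair → ℝ := fun ω => g (P.solMap N T_L T_R t z (pairPath ω)) with hF
  set F₀ : WienerPair → ℝ := fun ω => g (P.solMap N T_L₀ T_R₀ t z (pairPath ω)) with hF₀
  have hFm : Measurable F := hg.measurable.comp (pinnedChain_measurable_solMap_pairPath_right hω hl hβ hγ N T_L T_R t z)
  have hF₀m : Measurable F₀ :=
    hg.measurable.comp (pinnedChain_measurable_solMap_pairPath_right hω hl hβ hγ N T_L₀ T_R₀ t z)
  have hFi : Integrable F wienerPair := (integrable_const B).mono' hFm.aestronglyMeasurable
    (Eventually.of_forall fun ω => by rw [Real.norm_eq_abs]; exact hB _)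
  have hF₀i : Integrable F₀ wienerPair := (integrable_const B).mono' hF₀m.aestronglyMeasurable
    (Eventually.of_forall fun ω => by rw [Real.norm_eq_abs]; exact hB _)
  have hpt : ∀ ω, |F ω - F₀ ω| ≤ e / 2 + Gᶜ.indicator (fun _ => 2 * B) ω := by
    intro ω
    by_cases hωG : ω ∈ G
    · rw [indicator_of_notMem (Set.notMem_compl_iff.2 hωG), add_zero]
      -- noise paths and their bounds on `[0, t_max]`
      set η : ℝ → Fin N → ℝ := chainNoise N cL cR (pairPath ω) with hη
      set η₀ : ℝ → Fin N → ℝ := chainNoise N cL₀ cR₀ (pairPath ω) with hη₀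
      have hηc : Continuous η := continuous_chainNoise cL cR (pairPath ω)
      have hη₀c : Continuous η₀ := continuous_chainNoise cL₀ cR₀ (pairPath ω)
      have hBM : ∀ s ∈ Icc (0 : ℝ) tmax, |brownian s.toNNReal ω.1| ≤ a ∧ |brownian s.toNNReal ω.2| ≤ a := by
        intro s hs
        refine abs_brownian_toNNReal_le_of_mem_goodEvent hωG ?_
        rw [hh]; exact (Real.le_coe_toNNReal tmax).trans' hs.2
      have hnoise : ∀ (c₁ c₂ : ℝ) (b₁ b₂ : ℝ), |c₁| ≤ b₁ → |c₂| ≤ b₂ → ∀ s ∈ Icc (0 : ℝ) tmax,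
          ‖chainNoise N c₁ c₂ (pairPath ω) s‖ ≤ (b₁ + b₂) * a := by
        intro c₁ c₂ b₁ b₂ h1 h2 s hs
        obtain ⟨hb1, hb2⟩ := hBM s hs
        refine (norm_chainNoise_pairPath_le c₁ c₂ ω s).trans ?_
        have e1 := mul_le_mul h1 hb1 (abs_nonneg _) ((abs_nonneg _).trans h1)
        have e2 := mul_le_mul h2 hb2 (abs_nonneg _) ((abs_nonneg _).trans h2)
        linarith
      have hηM : ∀ s ∈ Icc (0 : ℝ) tmax, ‖η s‖ ≤ Mη := fun s hs => by
        refine (hnoise cL cR (cL₀ + 1) (cR₀ + 1) hcLb hcRb s hs).trans (le_of_eq ?_)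
        rw [hMη, hcM]; ring
      have hη₀M : ∀ s ∈ Icc (0 : ℝ) tmax, ‖η₀ s‖ ≤ Mη := fun s hs => by
        refine (hnoise cL₀ cR₀ (cL₀ + 1) (cR₀ + 1) hcL₀b hcR₀b s hs).trans (le_of_eq ?_)
        rw [hMη, hcM]; ring
      have hdiff : ∀ s ∈ Icc (0 : ℝ) tmax, ‖η s - η₀ s‖ ≤ δf := by
        intro s hs
        rw [hη, hη₀, chainNoise_sub]
        refine (hnoise (cL - cL₀) (cR - cR₀) ηa ηa hdL.le hdR.le s hs).trans ?_
        have h1 : ηa ≤ δf / (2 * a) := min_le_left _ _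
        calc (ηa + ηa) * a ≤ (δf / (2 * a) + δf / (2 * a)) * a := by gcongr
          _ = δf := by field_simp; ring
      -- the flows are close and in the a-priori ball
      have hclose := hflow z hz η η₀ hηc hη₀c hηM hη₀M hdiff t ht
      have hball₀ : P.chainFlow N z η₀ t ∈ closedBall (0 : PhaseSpace N) (Rap + 1) := by
        rw [mem_closedBall, dist_zero_right]
        refine ((pinnedChain_norm_chainFlow_le hω hl hβ hγ N z hη₀c hη₀M t ht).trans
          (pinnedChainRadius_mono hω N hz)).trans (by linarith)
      have hball : P.chainFlow N z η t ∈ closedBall (0 : PhaseSpace N) (Rap + 1) := by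
        rw [mem_closedBall, dist_zero_right]
        have h1 : ‖P.chainFlow N z η₀ t‖ ≤ Rap :=
          (pinnedChain_norm_chainFlow_le hω hl hβ hγ N z hη₀c hη₀M t ht).trans (pinnedChainRadius_mono hω N hz)
        have h2 : ‖P.chainFlow N z η t - P.chainFlow N z η₀ t‖ < 1 := hclose.trans_le (min_le_right _ _)
        calc ‖P.chainFlow N z η t‖ = ‖(P.chainFlow N z η t - P.chainFlow N z η₀ t) + P.chainFlow N z η₀ t‖ := by
              rw [sub_add_cancel]
          _ ≤ ‖P.chainFlow N z η t - P.chainFlow N z η₀ t‖ + ‖P.chainFlow N z η₀ t‖ := norm_add_le _ _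
          _ ≤ Rap + 1 := by linarith
      have hsol : P.solMap N T_L T_R t z (pairPath ω) = P.chainFlow N z η t := rfl
      have hsol₀ : P.solMap N T_L₀ T_R₀ t z (pairPath ω) = P.chainFlow N z η₀ t := rfl
      have hg' := huc _ hball _ hball₀ (by rw [dist_eq_norm]; exact hclose.trans_le (min_le_left _ _))
      rw [Real.dist_eq] at hg'
      rw [hF, hF₀]
      dsimp only
      rw [hsol, hsol₀]
      exact hg'.le
    · rw [indicator_of_mem hωG]
      have h1 := hB (P.solMap N T_L T_R t z (pairPath ω))
      have h2 := hB (P.solMap N T_L₀ T_R₀ t z (pairPath ω))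
      have h3 : |F ω - F₀ ω| ≤ |F ω| + |F₀ ω| := abs_sub _ _
      have : |F ω| + |F₀ ω| ≤ 2 * B := by rw [hF, hF₀]; dsimp only; linarith
      linarith
  -- (7) integrate
  have hind : Integrable (fun ω => Gᶜ.indicator (fun _ => 2 * B) ω) wienerPair :=
    (integrable_const (2 * B)).indicator hGm.compl
  have hbadR : (wienerPair Gᶜ).toReal ≤ e / (4 * (B + 1)) :=
    ENNReal.toReal_le_of_le_ofReal hq.le hbad
  rw [← integral_sub hFi hF₀i]
  calc |∫ ω, (F ω - F₀ ω) ∂wienerPair| ≤ ∫ ω, |F ω - F₀ ω| ∂wienerPair := abs_integral_le_integral_abs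
    _ ≤ ∫ ω, (e / 2 + Gᶜ.indicator (fun _ => 2 * B) ω) ∂wienerPair :=
        integral_mono (hFi.sub hF₀i).abs ((integrable_const _).add hind) hpt
    _ = e / 2 + (wienerPair Gᶜ).toReal * (2 * B) := by
        rw [integral_add (integrable_const _) hind, integral_const, probReal_univ, one_smul,
          integral_indicator_const _ hGm.compl, smul_eq_mul, measureReal_def]
    _ ≤ e / 2 + e / (4 * (B + 1)) * (2 * B) := by gcongr
    _ ≤ e := by
        have h1 : e / (4 * (B + 1)) * (2 * B) ≤ e / 2 := by
          rw [div_mul_eq_mul_div, div_le_div_iff₀ (by positivity) (by positivity)]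
          nlinarith
        linarith

/-- The tail of the exponential law of rate `r > 0`: `Exp_r(a, ∞) ≤ e^{-ra}` in real form (`a ≥ 0`; in fact an
equality). [folklore] -/
theorem expMeasure_real_Ioi_le {r : ℝ} (hr : 0 < r) {a : ℝ} (ha : 0 ≤ a) :
    (expMeasure r).real (Ioi a) ≤ Real.exp (-(r * a)) := by
  haveI := isProbabilityMeasure_expMeasure hr
  have h1 : 0 ≤ 1 - Real.exp (-(r * a)) := by
    have : Real.exp (-(r * a)) ≤ 1 := Real.exp_le_one_iff.2 (by nlinarith)
    linarith
  have h2 : Real.exp (-(r * a)) = 1 - (1 - Real.exp (-(r * a))) := by ring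
  have h3 : expMeasure r (Ioi a) = ENNReal.ofReal (Real.exp (-(r * a))) := by
    rw [← compl_Iic, prob_compl_eq_one_sub measurableSet_Iic, ← ofReal_cdf, cdf_expMeasure_eq hr, if_pos ha]
    conv_rhs => rw [h2]
    rw [ENNReal.ofReal_sub _ h1, ENNReal.ofReal_one]
  rw [measureReal_def, h3, ENNReal.toReal_ofReal (Real.exp_pos _).le]

/-- Truncation level for the exponential time: `t_max ≥ 0` with `e^{-r t_max} ≤ q` (`r, q > 0`). [folklore] -/
theorem exists_exp_neg_mul_le {r q : ℝ} (hr : 0 < r) (hq : 0 < q) :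
    ∃ tmax : ℝ, 0 ≤ tmax ∧ Real.exp (-(r * tmax)) ≤ q := by
  refine ⟨Real.log (1 / q + 1) / r, div_nonneg (Real.log_nonneg (by
    have : 0 < 1 / q := by positivity
    linarith)) hr.le, ?_⟩
  rw [mul_div_cancel₀ _ hr.ne', Real.exp_neg, Real.exp_log (by positivity)]
  rw [inv_le_comm₀ (by positivity) hq, ← one_div]
  linarith

set_option maxHeartbeats 800000 in
/-- **The resolvent of a bounded continuous observable is continuous in the bath temperatures, uniformly on energy
sublevel sets.** For `pinnedChain ω₂ lam β γ` (`ω₂ > 0`, `lam, β, γ ≥ 0`, `N ≥ 1`), a rate `r > 0`, a bounded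
continuous `g` (`|g| ≤ B`), an energy level `E`, base temperatures `T_L⁰, T_R⁰ ≥ 0` and `e > 0` there is `δ' > 0`
such that for all `T_L, T_R ≥ 0` with `|T_L − T_L⁰|, |T_R − T_R⁰| < δ'` and all `z` with `H(z) ≤ E`,
`|R_r g(z) − R⁰_r g(z)| ≤ e` (`R_r`, `R⁰_r` the resolvent kernels of the flip-free dynamics at `(T_L, T_R)` and
`(T_L⁰, T_R⁰)`): truncate the exponential time at `t_max` (`2B e^{-r t_max} ≤ e/2`) and use
`flow_expectation_continuous_temps` on `[0, t_max]`. [cite: CuneoEckmannHairerReyBellet2018, §3.1 Cor. 3.4] -/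
theorem resolvent_continuous_temps (hω : 0 < ω₂) (hl : 0 ≤ lam) (hβ : 0 ≤ β) (hγ : 0 ≤ γ) (hN : 0 < N)
    {r : ℝ} (hr : 0 < r) {g : PhaseSpace N → ℝ} (hg : Continuous g) {B : ℝ} (hB : ∀ x, |g x| ≤ B) (E : ℝ)
    {T_L₀ T_R₀ : ℝ} (h0L : 0 ≤ T_L₀) (h0R : 0 ≤ T_R₀) {e : ℝ} (he : 0 < e) :
    ∃ δ' : ℝ, 0 < δ' ∧ ∀ (T_L T_R : ℝ) (hTL : 0 ≤ T_L) (hTR : 0 ≤ T_R), |T_L - T_L₀| < δ' → |T_R - T_R₀| < δ' →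
      ∀ z : PhaseSpace N, (pinnedChain ω₂ lam β γ).hamiltonian N z ≤ E →
        |∫ y, g y ∂((pinnedChainSemigroup hω hl hβ hγ hN hTL hTR).resolventKernel r z) -
            ∫ y, g y ∂((pinnedChainSemigroup hω hl hβ hγ hN h0L h0R).resolventKernel r z)| ≤ e := by
  set P := pinnedChain ω₂ lam β γ with hP
  have hB0 : 0 ≤ B := (abs_nonneg _).trans (hB 0)
  haveI := isProbabilityMeasure_expMeasure hr
  set ρ := expMeasure r with hρ
  -- the truncation level
  have hq : 0 < e / (4 * (B + 1)) := by positivity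
  obtain ⟨tmax, htmax0, htmax⟩ := exists_exp_neg_mul_le hr hq
  obtain ⟨δ', hδ', hcont⟩ := flow_expectation_continuous_temps (N := N) hω hl hβ hγ hg hB E tmax T_L₀ T_R₀
    (half_pos he)
  refine ⟨δ', hδ', fun T_L T_R hTL hTR hdL hdR z hz => ?_⟩
  set S := pinnedChainSemigroup hω hl hβ hγ hN hTL hTR with hS
  set S₀ := pinnedChainSemigroup hω hl hβ hγ hN h0L h0R with hS₀
  have hgn : ∀ y, ‖g y‖ ≤ B := fun y => by rw [Real.norm_eq_abs]; exact hB y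
  rw [S.integral_resolventKernel hr z hg.stronglyMeasurable hgn,
    S₀.integral_resolventKernel hr z hg.stronglyMeasurable hgn]
  -- the two orbits as functions of the real time
  set φ : ℝ → ℝ := fun t => S.act t.toNNReal g z with hφ
  set φ₀ : ℝ → ℝ := fun t => S₀.act t.toNNReal g z with hφ₀
  have hmeas : ∀ (S' : LangevinChainSemigroup P N T_L T_R), StronglyMeasurable fun t : ℝ => S'.act t.toNNReal g z := by
    intro S'
    have h1 : (fun t : ℝ => S'.act t.toNNReal g z) = fun t => ∫ y, g y ∂(S'.timeKernel (t, z)) := rfl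
    rw [h1]
    exact (hg.stronglyMeasurable.integral_kernel (κ := S'.timeKernel)).comp_measurable
      (measurable_id.prodMk measurable_const)
  have hmeas₀ : ∀ (S' : LangevinChainSemigroup P N T_L₀ T_R₀), StronglyMeasurable fun t : ℝ => S'.act t.toNNReal g z := by
    intro S'
    have h1 : (fun t : ℝ => S'.act t.toNNReal g z) = fun t => ∫ y, g y ∂(S'.timeKernel (t, z)) := rfl
    rw [h1]
    exact (hg.stronglyMeasurable.integral_kernel (κ := S'.timeKernel)).comp_measurable
      (measurable_id.prodMk measurable_const)
  have hbdd : ∀ {T₁ T₂ : ℝ} (S' : LangevinChainSemigroup P N T₁ T₂) (t : ℝ), |S'.act t.toNNReal g z| ≤ B := by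
    intro T₁ T₂ S' t
    rw [LangevinChainSemigroup.act_apply, ← Real.norm_eq_abs]
    have := norm_integral_le_of_norm_le_const (μ := S'.kernel t.toNNReal z) (Eventually.of_forall hgn)
    rwa [probReal_univ, mul_one] at this
  have hφi : Integrable φ ρ := (integrable_const B).mono' (hmeas S).aestronglyMeasurable
    (Eventually.of_forall fun t => by rw [Real.norm_eq_abs]; exact hbdd S t)
  have hφ₀i : Integrable φ₀ ρ := (integrable_const B).mono' (hmeas₀ S₀).aestronglyMeasurable
    (Eventually.of_forall fun t => by rw [Real.norm_eq_abs]; exact hbdd S₀ t)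
  -- pointwise: `|φ − φ₀| ≤ e/2 + 2B·1_{t > t_max}`
  have hpt : ∀ t, |φ t - φ₀ t| ≤ e / 2 + (Ioi tmax).indicator (fun _ => 2 * B) t := by
    intro t
    by_cases ht : t ≤ tmax
    · rw [indicator_of_notMem (fun h' : t ∈ Ioi tmax => not_lt.2 ht h'), add_zero]
      have htt : ((t.toNNReal : ℝ≥0) : ℝ) ∈ Icc (0 : ℝ) tmax :=
        ⟨(t.toNNReal).coe_nonneg, by rw [Real.coe_toNNReal']; exact max_le ht htmax0⟩
      have h1 := hcont T_L T_R hdL hdR z hz _ htt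
      rw [hφ, hφ₀]
      dsimp only
      rw [LangevinChainSemigroup.act_apply, LangevinChainSemigroup.act_apply, pinnedChainSemigroup_kernel,
        pinnedChainSemigroup_kernel,
        pinnedChain_integral_transitionKernel hω hl hβ hγ N T_L T_R _ z hg.aestronglyMeasurable,
        pinnedChain_integral_transitionKernel hω hl hβ hγ N T_L₀ T_R₀ _ z hg.aestronglyMeasurable]
      exact h1
    · rw [indicator_of_mem (show t ∈ Ioi tmax from lt_of_not_ge ht)]
      have h1 := hbdd S t
      have h2 := hbdd S₀ t
      have h3 : |φ t - φ₀ t| ≤ |φ t| + |φ₀ t| := abs_sub _ _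
      have : |φ t| + |φ₀ t| ≤ 2 * B := by rw [hφ, hφ₀]; dsimp only; linarith
      linarith
  have hind : Integrable (fun t => (Ioi tmax).indicator (fun _ => 2 * B) t) ρ :=
    (integrable_const (2 * B)).indicator measurableSet_Ioi
  have htail : ρ.real (Ioi tmax) ≤ e / (4 * (B + 1)) := by
    rw [hρ]
    exact (expMeasure_real_Ioi_le hr htmax0).trans htmax
  rw [← integral_sub hφi hφ₀i]
  calc |∫ t, (φ t - φ₀ t) ∂ρ| ≤ ∫ t, |φ t - φ₀ t| ∂ρ := abs_integral_le_integral_abs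
    _ ≤ ∫ t, (e / 2 + (Ioi tmax).indicator (fun _ => 2 * B) t) ∂ρ :=
        integral_mono (hφi.sub hφ₀i).abs ((integrable_const _).add hind) hpt
    _ = e / 2 + ρ.real (Ioi tmax) * (2 * B) := by
        rw [integral_add (integrable_const _) hind, integral_const, probReal_univ, one_smul,
          integral_indicator_const _ measurableSet_Ioi, smul_eq_mul]
    _ ≤ e / 2 + e / (4 * (B + 1)) * (2 * B) := by gcongr
    _ ≤ e := by
        have h1 : e / (4 * (B + 1)) * (2 * B) ≤ e / 2 := by
          rw [div_mul_eq_mul_div, div_le_div_iff₀ (by positivity) (by positivity)]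
          nlinarith
        linarith

/-! ## Registered helper -/

/-- Registered helper sub-goal `helper_flipMildContinuityFlow` of stub `stub_flipMildContinuity` (line
`fekete-usc-one-length`, crux stmt-AtomisticToContinuum-11976): continuity of the resolvent of bounded continuous
observables in the bath temperatures, uniformly on energy sublevel sets (`resolvent_continuous_temps`, notation-free
one-line form). -/
theorem helper_flipMildContinuityFlow : ∀ (ω₂ lam β γ : ℝ) (hω : 0 < ω₂) (hl : 0 ≤ lam) (hβ : 0 ≤ β) (hγ : 0 ≤ γ) (N : ℕ) (hN : 0 < N) (r : ℝ), 0 < r → ∀ (g : Literature.MathematicalPhysics.KineticTheory.HeatConduction.PhaseSpace N → ℝ), Continuous g → ∀ (B : ℝ), (∀ x, |g x| ≤ B) → ∀ (E T_L₀ T_R₀ : ℝ) (h0L : 0 ≤ T_L₀) (h0R : 0 ≤ T_R₀) (e : ℝ), 0 < e → ∃ δ' : ℝ, 0 < δ' ∧ ∀ (T_L T_R : ℝ) (hTL : 0 ≤ T_L) (hTR : 0 ≤ T_R), |T_L - T_L₀| < δ' → |T_R - T_R₀| < δ' → ∀ z : Literature.MathematicalPhysics.KineticTheory.HeatConduction.PhaseSpace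 N, (Literature.MathematicalPhysics.KineticTheory.HeatConduction.pinnedChain ω₂ lam β γ).hamiltonian N z ≤ E → |MeasureTheory.integral ((Literature.MathematicalPhysics.KineticTheory.HeatConduction.pinnedChainSemigroup hω hl hβ hγ hN hTL hTR).resolventKernel r z) (fun y => g y) - MeasureTheory.integral ((Literature.MathematicalPhysics.KineticTheory.HeatConduction.pinnedChainSemigroup hω hl hβ hγ hN h0L h0R).resolventKernel r z) (fun y => g y)| ≤ e :=
  fun _ _ _ _ hω hl hβ hγ _ hN _ hr _ hg _ hB E _ _ h0L h0R _ he =>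
    resolvent_continuous_temps hω hl hβ hγ hN hr hg hB E h0L h0R he

end Summit.AtomisticToContinuum.FouriersLaw.Theorems.VanishingNoiseBound

end
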